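import Summits.QuantumFields.YangMills.Theorems.BalabanUVNodesN21FirstExceedanceHazardDefect
import Summits.QuantumFields.YangMills.Theorems.BalabanUVNodesN21LeftNonCollapseHazard

/-!
# N21 (NE7c) · road II leftward WITH A DEFECT EVENT — cross-dependent, transversally-read variables on CUT laws

R134 seat pub-ymgap-dag-n21-d (g8), node N21 = NE7c (single-run shell-weight bound, NOT PRINTED in [Bałaban 1983–89],
NOT proved), lane K3⁷ `SpineGivenEndpointR13SepCoPH` (stmt-QuantumFields-20544, `--kind proof --supports … --as helper`).
Part 15 of the comparison series; consumes part 12 (`…N21FirstExceedanceHazardDefect`: Tonelli for arbitrary sets,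
`measure_le_of_fibrewise`) and part 14 (`…N21LeftNonCollapseHazard`: the LEFT device of lens Card 65 and the pre-shell
count).

WHAT THIS FILE IS.  Part 14 §K knitted the LEFT device on `ℝ^ι` for tested variables that ARE coordinates (no
cross-dependence: moving down a fibre never exits the other variables' sub-level events).  For tested variables reading
SEVERAL coordinates (bond-sharing plaquettes) a downward move along `x_p` can push a neighbour `u_q` with negative
sensitivity UP across its threshold — the fibre EXITS the conditioning event.  As in part 12 (rightward), the remedy is a
DEFECT EVENT:
* §1 `setLIntegral_le_of_nonCollapse_into_left` — part 10 §1 mirrored: left `δ`-neighbourhoods of `S` inside `T` and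
  `f(x) ≤ M·f(y)` on them ⇒ `∫_S f ≤ M·|S|∕δ · ∫_T f`.
* §2 `measure_shell_inter_le_of_fibrewise_exit_left` — a tested variable `w` read along `x_p` with slope `≥ κ`, a
  density (ANY, cuts included) non-collapsing to the LEFT by `M` within `δ` at shell points, a conditioning event `C`
  that MAY read `x_p`, and a measurable `B` off which the fibre does not exit `C` within `δ` downward:
  `ν({a ≤ w < b} ∩ C) ≤ M·2(b−a)∕(κδ) · ν({w < b} ∩ C) + ν({a ≤ w < b} ∩ C ∩ B)`; with a two-sided slope
  `κ ≤ ∂w ≤ κ'` the reference event sharpens to the PRE-SHELL `{a − κ'δ ≤ w < b} ∩ C`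
  (`measure_shell_inter_le_preShell_of_fibrewise_exit_left`).
* §3 knit (union bound keeping the sub-threshold event, part 14 `measure_shell_iSup_le_sum_inter`): for
  `ν = g dx` on `ℝ^ι`, `g` ANY measurable density, tested `u_p` arbitrary measurable with `κ ≤` slope along own
  coordinate `≤ κ'`, LEFT non-collapse by `M` within `δ`, and `B` covering all downward exits:
  `ν{a ≤ ⨆ u < b} ≤ M·2(b−a)∕(κδ) · Σ_p ν({a − κ'δ ≤ u_p < b} ∩ {u_q < b, q ≠ p}) + Σ_p ν({a ≤ u_p < b} ∩ {u_q < b, q ≠ p} ∩ B)`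
  (`measure_shell_iSup_le_preShellCount_defect`) — pre-shell count + double-shell defect, on cut laws.

HONEST FRAMING.  [textbook] measure theory; 0 def, 0 sorry; the rightward∕leftward distinction and the «which law»
answer are in part 14's header (lens v22.0 ROW L); nothing claimed for Bałaban's measure; NE7c NOT PRINTED ∕ NOT proved;
N21 NOT discharged; counts unmoved (typed 28∕28 · discharged 5∕27); count-neutral; one finite 𝕋⁴ at fixed ε — nothing
about ℝ⁴ ∕ OS ∕ mass gap ∕ Clay.
-/

open MeasureTheory Set Function
open scoped ENNReal NNReal

namespace Summit.QuantumFields.YangMills.Theorems.N21LeftHazardDefect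

open Summit.QuantumFields.YangMills.Theorems.N21FirstExceedanceHazardDefect (measure_le_of_fibrewise)
open Summit.QuantumFields.YangMills.Theorems.N21TransversalGibbsHazard (volume_preimage_Ico_le)
open Summit.QuantumFields.YangMills.Theorems.N21LeftNonCollapseHazard (measure_shell_iSup_le_sum_inter)

/-! ## §1 Non-collapse into a target set, LEFT version -/

/-- **NON-COLLAPSE INTO `T`, LEFTWARD.**  `f(x) ≤ M·f(y)` for `x ∈ S`, `y ∈ [x − δ, x] ⊆ T` (`δ > 0`) ⇒
`∫_S f ≤ M · |S|∕δ · ∫_T f` (Lebesgue). [textbook] -/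
theorem setLIntegral_le_of_nonCollapse_into_left {f : ℝ → ℝ≥0∞} (hf : Measurable f) {S T : Set ℝ}
    (hS : MeasurableSet S) {δ : ℝ} (hδ : 0 < δ) (M : ℝ≥0∞) (hT : ∀ x ∈ S, Icc (x - δ) x ⊆ T)
    (h : ∀ x ∈ S, ∀ y ∈ Icc (x - δ) x, f x ≤ M * f y) :
    ∫⁻ x in S, f x ≤ M * (volume S * (ENNReal.ofReal δ)⁻¹) * ∫⁻ y in T, f y := by
  set I := ∫⁻ y in T, f y with hI
  have hδ0 : ENNReal.ofReal δ ≠ 0 := (ENNReal.ofReal_pos.2 hδ).ne'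
  have hδtop : ENNReal.ofReal δ ≠ ⊤ := ENNReal.ofReal_ne_top
  have hpt : ∀ x ∈ S, f x ≤ (ENNReal.ofReal δ)⁻¹ * (M * I) := by
    intro x hx
    have h1 : ENNReal.ofReal δ * f x ≤ M * I := by
      calc ENNReal.ofReal δ * f x = ∫⁻ _ in Icc (x - δ) x, f x := by
            rw [setLIntegral_const, Real.volume_Icc, mul_comm]
            congr 2
            ring
        _ ≤ ∫⁻ y in Icc (x - δ) x, M * f y := setLIntegral_mono' measurableSet_Icc fun y hy => h x hx y hy
        _ = M * ∫⁻ y in Icc (x - δ) x, f y := lintegral_const_mul M hf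
        _ ≤ M * I := mul_le_mul_right (lintegral_mono_set (hT x hx)) _
    calc f x = (ENNReal.ofReal δ)⁻¹ * (ENNReal.ofReal δ * f x) := by
          rw [← mul_assoc, ENNReal.inv_mul_cancel hδ0 hδtop, one_mul]
      _ ≤ (ENNReal.ofReal δ)⁻¹ * (M * I) := mul_le_mul_right h1 _
  calc ∫⁻ x in S, f x ≤ ∫⁻ _ in S, (ENNReal.ofReal δ)⁻¹ * (M * I) := setLIntegral_mono' hS hpt
    _ = (ENNReal.ofReal δ)⁻¹ * (M * I) * volume S := by rw [setLIntegral_const]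
    _ = M * (volume S * (ENNReal.ofReal δ)⁻¹) * I := by ring

/-! ## §2 The fibre with exit, LEFT version -/

section Fibre

variable {ι : Type*} [Fintype ι] [DecidableEq ι]

/-- **THE FIBRE WITH EXIT, LEFTWARD, relative to a target event along the fibre.**  `ν = (pi volume).withDensity g` on
`ℝ^ι` (`g` ANY measurable density); a tested variable `w` whose reading along the `p`-fibre has slope `≥ κ > 0`; `g`
non-collapsing by `M` within `δ > 0` to the LEFT of every fibre point with `w ∈ [a, b)` (`a ≤ b`); measurable `C`, `B`
and a measurable target `F ⊇` the left `δ`-neighbourhoods (along the fibre) of the good points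
`{a ≤ w < b} ∩ C ∖ B`.  Then `ν({a ≤ w < b} ∩ C) ≤ M·2(b − a)∕(κδ) · ν F + ν({a ≤ w < b} ∩ C ∩ B)`. [textbook] -/
theorem measure_shell_inter_le_of_fibrewise_exit_left_into {g : (ι → ℝ) → ℝ≥0∞} (hg : Measurable g) (p : ι)
    {w : (ι → ℝ) → ℝ} (hw : Measurable w) {κ a b δ : ℝ} (hκ : 0 < κ) (hab : a ≤ b) (hδ : 0 < δ) {M : ℝ}
    (hM : 0 ≤ M) (hslope : ∀ x : ι → ℝ, ∀ y₁ y₂, y₁ ≤ y₂ → κ * (y₂ - y₁) ≤ w (update x p y₂) - w (update x p y₁))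
    (hnc : ∀ x : ι → ℝ, w x ∈ Ico a b → ∀ y ∈ Icc (x p - δ) (x p), g x ≤ ENNReal.ofReal M * g (update x p y))
    {C B F : Set (ι → ℝ)} (hC : MeasurableSet C) (hB : MeasurableSet B) (hF : MeasurableSet F)
    (hinto : ∀ x : ι → ℝ, x ∈ C → x ∉ B → w x ∈ Ico a b → ∀ y ∈ Icc (x p - δ) (x p), update x p y ∈ F) :
    (Measure.pi fun _ : ι => (volume : Measure ℝ)).withDensity g ({x | a ≤ w x ∧ w x < b} ∩ C)
      ≤ ENNReal.ofReal (M * (2 * (b - a) / (κ * δ)))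
          * (Measure.pi fun _ : ι => (volume : Measure ℝ)).withDensity g F
        + (Measure.pi fun _ : ι => (volume : Measure ℝ)).withDensity g ({x | a ≤ w x ∧ w x < b} ∩ C ∩ B) := by
  have hSm : MeasurableSet ({x | a ≤ w x ∧ w x < b} ∩ C) :=
    ((measurableSet_le measurable_const hw).inter (measurableSet_lt hw measurable_const)).inter hC
  set S := {x | a ≤ w x ∧ w x < b} ∩ C with hS
  have hsplit : S ⊆ (S \ B) ∪ (S ∩ B) := fun x hx => by
    by_cases hxB : x ∈ B
    · exact Or.inr ⟨hx, hxB⟩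
    · exact Or.inl ⟨hx, hxB⟩
  refine ((measure_mono hsplit).trans (measure_union_le _ _)).trans (add_le_add ?_ le_rfl)
  refine measure_le_of_fibrewise hg p (hSm.diff hB) hF _ ENNReal.ofReal_ne_top fun x => ?_
  have hgx : Measurable fun y => g (update x p y) := hg.comp (measurable_update x)
  have hS'm : MeasurableSet ((update x p) ⁻¹' (S \ B)) := (measurable_update x) (hSm.diff hB)
  have hT : ∀ y₁ ∈ (update x p) ⁻¹' (S \ B), Icc (y₁ - δ) y₁ ⊆ (update x p) ⁻¹' F := by
    intro y₁ hy₁ y₂ hy₂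
    obtain ⟨⟨⟨ha, hb⟩, hC₁⟩, hB₁⟩ := hy₁
    have hy₂' : y₂ ∈ Icc ((update x p y₁) p - δ) ((update x p y₁) p) := by simpa using hy₂
    have h := hinto (update x p y₁) hC₁ hB₁ ⟨ha, hb⟩ y₂ hy₂'
    rwa [update_idem] at h
  have hnc' : ∀ y₁ ∈ (update x p) ⁻¹' (S \ B), ∀ y₂ ∈ Icc (y₁ - δ) y₁,
      g (update x p y₁) ≤ ENNReal.ofReal M * g (update x p y₂) := by
    intro y₁ hy₁ y₂ hy₂
    obtain ⟨⟨⟨ha, hb⟩, -⟩, -⟩ := hy₁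
    have hy₂' : y₂ ∈ Icc ((update x p y₁) p - δ) ((update x p y₁) p) := by simpa using hy₂
    have := hnc (update x p y₁) ⟨ha, hb⟩ y₂ hy₂'
    rwa [update_idem] at this
  have h1 := setLIntegral_le_of_nonCollapse_into_left hgx hS'm hδ (ENNReal.ofReal M) hT hnc'
  refine h1.trans (mul_le_mul_left ?_ _)
  have hsub : (update x p) ⁻¹' (S \ B) ⊆ (fun y => w (update x p y)) ⁻¹' Ico a b := fun y hy => hy.1.1
  have hvol : volume ((update x p) ⁻¹' (S \ B)) ≤ ENNReal.ofReal (2 * (b - a) / κ) :=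
    (measure_mono hsub).trans (volume_preimage_Ico_le hκ (fun y₁ y₂ h => hslope x y₁ y₂ h) a b)
  have h2 : 0 ≤ 2 * (b - a) / κ := div_nonneg (by linarith) hκ.le
  calc ENNReal.ofReal M * (volume ((update x p) ⁻¹' (S \ B)) * (ENNReal.ofReal δ)⁻¹)
      ≤ ENNReal.ofReal M * (ENNReal.ofReal (2 * (b - a) / κ) * (ENNReal.ofReal δ)⁻¹) := by gcongr
    _ = ENNReal.ofReal (M * (2 * (b - a) / (κ * δ))) := by
        rw [← ENNReal.ofReal_inv_of_pos hδ, ← ENNReal.ofReal_mul h2, ← ENNReal.ofReal_mul hM]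
        congr 1
        field_simp

/-- **… relative to the SUB-THRESHOLD event** `{w < b} ∩ C` (the target of every downward move that stays in `C`:
the reading only decreases). [textbook] -/
theorem measure_shell_inter_le_of_fibrewise_exit_left {g : (ι → ℝ) → ℝ≥0∞} (hg : Measurable g) (p : ι)
    {w : (ι → ℝ) → ℝ} (hw : Measurable w) {κ a b δ : ℝ} (hκ : 0 < κ) (hab : a ≤ b) (hδ : 0 < δ) {M : ℝ}
    (hM : 0 ≤ M) (hslope : ∀ x : ι → ℝ, ∀ y₁ y₂, y₁ ≤ y₂ → κ * (y₂ - y₁) ≤ w (update x p y₂) - w (update x p y₁))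
    (hnc : ∀ x : ι → ℝ, w x ∈ Ico a b → ∀ y ∈ Icc (x p - δ) (x p), g x ≤ ENNReal.ofReal M * g (update x p y))
    {C B : Set (ι → ℝ)} (hC : MeasurableSet C) (hB : MeasurableSet B)
    (hexit : ∀ x : ι → ℝ, x ∈ C → x ∉ B → w x ∈ Ico a b → ∀ y ∈ Icc (x p - δ) (x p), update x p y ∈ C) :
    (Measure.pi fun _ : ι => (volume : Measure ℝ)).withDensity g ({x | a ≤ w x ∧ w x < b} ∩ C)
      ≤ ENNReal.ofReal (M * (2 * (b - a) / (κ * δ)))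
          * (Measure.pi fun _ : ι => (volume : Measure ℝ)).withDensity g ({x | w x < b} ∩ C)
        + (Measure.pi fun _ : ι => (volume : Measure ℝ)).withDensity g ({x | a ≤ w x ∧ w x < b} ∩ C ∩ B) := by
  refine measure_shell_inter_le_of_fibrewise_exit_left_into hg p hw hκ hab hδ hM hslope hnc hC hB
    ((measurableSet_lt hw measurable_const).inter hC) fun x hxC hxB hx y hy => ⟨?_, hexit x hxC hxB hx y hy⟩
  -- the reading only decreases along a downward move
  have h1 := hslope x y (x p) hy.2
  have h2 : 0 ≤ κ * (x p - y) := mul_nonneg hκ.le (by linarith [hy.2])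
  show w (update x p y) < b
  have : w (update x p (x p)) = w x := by rw [update_eq_self]
  linarith [hx.2]

/-- **… relative to the PRE-SHELL event** `{a − κ'δ ≤ w < b} ∩ C` when the reading's slope is also bounded ABOVE by
`κ'` (a downward move of length `≤ δ` lowers the reading by at most `κ'δ`). [textbook] -/
theorem measure_shell_inter_le_preShell_of_fibrewise_exit_left {g : (ι → ℝ) → ℝ≥0∞} (hg : Measurable g) (p : ι)
    {w : (ι → ℝ) → ℝ} (hw : Measurable w) {κ κ' a b δ : ℝ} (hκ : 0 < κ) (hab : a ≤ b) (hδ : 0 < δ) {M : ℝ}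
    (hM : 0 ≤ M) (hslope : ∀ x : ι → ℝ, ∀ y₁ y₂, y₁ ≤ y₂ → κ * (y₂ - y₁) ≤ w (update x p y₂) - w (update x p y₁))
    (hslope' : ∀ x : ι → ℝ, ∀ y₁ y₂, y₁ ≤ y₂ → w (update x p y₂) - w (update x p y₁) ≤ κ' * (y₂ - y₁))
    (hnc : ∀ x : ι → ℝ, w x ∈ Ico a b → ∀ y ∈ Icc (x p - δ) (x p), g x ≤ ENNReal.ofReal M * g (update x p y))
    {C B : Set (ι → ℝ)} (hC : MeasurableSet C) (hB : MeasurableSet B)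
    (hexit : ∀ x : ι → ℝ, x ∈ C → x ∉ B → w x ∈ Ico a b → ∀ y ∈ Icc (x p - δ) (x p), update x p y ∈ C) :
    (Measure.pi fun _ : ι => (volume : Measure ℝ)).withDensity g ({x | a ≤ w x ∧ w x < b} ∩ C)
      ≤ ENNReal.ofReal (M * (2 * (b - a) / (κ * δ)))
          * (Measure.pi fun _ : ι => (volume : Measure ℝ)).withDensity g ({x | a - κ' * δ ≤ w x ∧ w x < b} ∩ C)
        + (Measure.pi fun _ : ι => (volume : Measure ℝ)).withDensity g ({x | a ≤ w x ∧ w x < b} ∩ C ∩ B) := by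
  refine measure_shell_inter_le_of_fibrewise_exit_left_into hg p hw hκ hab hδ hM hslope hnc hC hB
    (((measurableSet_le measurable_const hw).inter (measurableSet_lt hw measurable_const)).inter hC)
    fun x hxC hxB hx y hy => ⟨⟨?_, ?_⟩, hexit x hxC hxB hx y hy⟩
  · have h1 := hslope' x y (x p) hy.2
    -- the two slope bounds at `(0, 1)` give `κ ≤ κ'`, so `κ' > 0`
    have hκ' : 0 ≤ κ' := by
      have h3 := hslope x 0 1 (by norm_num)
      have h4 := hslope' x 0 1 (by norm_num)
      linarith
    have h2 : κ' * (x p - y) ≤ κ' * δ := mul_le_mul_of_nonneg_left (by linarith [hy.1]) hκ'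
    have hx0 : w (update x p (x p)) = w x := by rw [update_eq_self]
    show a - κ' * δ ≤ w (update x p y)
    linarith [hx.1]
  · have h1 := hslope x y (x p) hy.2
    have h2 : 0 ≤ κ * (x p - y) := mul_nonneg hκ.le (by linarith [hy.2])
    have hx0 : w (update x p (x p)) = w x := by rw [update_eq_self]
    show w (update x p y) < b
    linarith [hx.2]

end Fibre

/-! ## §3 Knit on cut laws: pre-shell count + double-shell defect -/

section Knit

variable {ι : Type*} [Fintype ι] [DecidableEq ι] [Nonempty ι]

/-- **THE SHELL OF THE MAXIMUM ON A CUT LAW, CROSS-DEPENDENT VARIABLES: PRE-SHELL COUNT + DEFECT.**  `ν = g dx` on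
`ℝ^ι`, `g` ANY measurable density (cuts included); tested `u_p` arbitrary measurable functions of all coordinates with
`κ ≤` slope along own coordinate `≤ κ'`; LEFT non-collapse by `M` within `δ` at shell points; `B` measurable covering
every downward exit of every event `{u_q < b, q ≠ p}`.  Then
`ν{a ≤ ⨆ u < b} ≤ M·2(b−a)∕(κδ) · Σ_p ν({a − κ'δ ≤ u_p < b} ∩ {u_q < b, q ≠ p}) + Σ_p ν({a ≤ u_p < b} ∩ {u_q < b, q ≠ p} ∩ B)`.
[textbook] -/
theorem measure_shell_iSup_le_preShellCount_defect {g : (ι → ℝ) → ℝ≥0∞} (hg : Measurable g)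
    {u : ι → (ι → ℝ) → ℝ} (hu : ∀ p, Measurable (u p)) {κ κ' a b δ M : ℝ} (hκ : 0 < κ) (hab : a ≤ b)
    (hδ : 0 < δ) (hM : 0 ≤ M)
    (hslope : ∀ p (x : ι → ℝ) (y₁ y₂ : ℝ), y₁ ≤ y₂ → κ * (y₂ - y₁) ≤ u p (update x p y₂) - u p (update x p y₁))
    (hslope' : ∀ p (x : ι → ℝ) (y₁ y₂ : ℝ), y₁ ≤ y₂ → u p (update x p y₂) - u p (update x p y₁) ≤ κ' * (y₂ - y₁))
    (hnc : ∀ p (x : ι → ℝ), u p x ∈ Ico a b → ∀ y ∈ Icc (x p - δ) (x p),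
      g x ≤ ENNReal.ofReal M * g (update x p y))
    {B : Set (ι → ℝ)} (hB : MeasurableSet B)
    (hexit : ∀ p (x : ι → ℝ), (∀ q, q ≠ p → u q x < b) → x ∉ B → u p x ∈ Ico a b →
      ∀ y ∈ Icc (x p - δ) (x p), ∀ q, q ≠ p → u q (update x p y) < b) :
    (Measure.pi fun _ : ι => (volume : Measure ℝ)).withDensity g {x | a ≤ ⨆ p, u p x ∧ ⨆ p, u p x < b}
      ≤ ENNReal.ofReal (M * (2 * (b - a) / (κ * δ)))
          * ∑ p, (Measure.pi fun _ : ι => (volume : Measure ℝ)).withDensity g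
              ({x | a - κ' * δ ≤ u p x ∧ u p x < b} ∩ {x | ∀ q, q ≠ p → u q x < b})
        + ∑ p, (Measure.pi fun _ : ι => (volume : Measure ℝ)).withDensity g
              ({x | a ≤ u p x ∧ u p x < b} ∩ {x | ∀ q, q ≠ p → u q x < b} ∩ B) := by
  refine (measure_shell_iSup_le_sum_inter _ u a b).trans ?_
  rw [Finset.mul_sum, ← Finset.sum_add_distrib]
  refine Finset.sum_le_sum fun p _ => ?_
  have hC : MeasurableSet {x : ι → ℝ | ∀ q, q ≠ p → u q x < b} := by
    have : {x : ι → ℝ | ∀ q, q ≠ p → u q x < b} = ⋂ q, {x | q ≠ p → u q x < b} := by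
      ext x; simp only [mem_setOf_eq, mem_iInter]
    rw [this]
    refine MeasurableSet.iInter fun q => ?_
    by_cases hq : q = p
    · have : {x : ι → ℝ | q ≠ p → u q x < b} = univ := by
        ext x; simp [hq]
      rw [this]; exact MeasurableSet.univ
    · have : {x : ι → ℝ | q ≠ p → u q x < b} = {x | u q x < b} := by
        ext x; simp [hq]
      rw [this]; exact measurableSet_lt (hu q) measurable_const
  exact measure_shell_inter_le_preShell_of_fibrewise_exit_left hg p (hu p) hκ hab hδ hM (hslope p) (hslope' p)
    (hnc p) hC hB (fun x hxC hxB hx y hy => hexit p x hxC hxB hx y hy)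

end Knit

end Summit.QuantumFields.YangMills.Theorems.N21LeftHazardDefect
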